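import Literature.MathematicalPhysics.QuantumFieldTheory.Balaban1983to89.B5G183RateW1Diag

/-!
# Bałaban [CMP 95 (1984)] (1.83)/(1.89) at `U = 1`: the x-BLOCK PIECE `R` of the order-two eta-rate
in the currency `W∂_ν ⊗ W∂_{ν′}` (ONE King weight per derivative) has the full rate `γ = 1`

HONEST FRAMING (cell `pub-balaban`, T⁴ programme, estimate NE2 = U1a «η-rate, linear theory»).  Finite
torus, lattice spacing `η = 1/n`, trivial background `U = 1`, one nonzero reduced momentum `p′ = s` at a
time, `ℓ²`-operator norm on the alias classes `× Fin d`.  Nothing here is about infinite volume, `U ≠ 1`,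
a mass gap, or any summit statement.  Bałaban prints NO rate; the currency, King's pairing `ι`/`plant`
and every constant are OURS ([folklore]).

WHAT IS PRINTED.  [Balaban1984PropagatorsI] p. 31 (1.83): the second term of `G(p′)`,
`−a Σ_μ φ_μ⁻¹ x_μ ⊗ x̄_μ` (b05's block `R`, coefficient `cR = −aφ_μ⁻¹`, vectors `x_μ(l)`, `l ≠ 0`);
p. 33: «Proposition 1.1. The operator G is a symmetric operator on L²(T_η) and ‖GJ‖, ‖∇GJ‖, ‖G∇*J‖,
‖∇G∇*J‖, ‖∇∇GJ‖, ‖G∇*∇*J‖ ≤ γ₀⁻¹‖J‖, (1.89)».  [King1986] p. 672: «To analyze the m = 0 term in (4.19),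
we successively replace each factor by the corresponding one … and bound the error.», (4.20)
`|u(p′+l)| ≤ Π_μ |p′_μ||p′_μ + l_μ|⁻¹`.  (renders ref1 p015–p017, king p024/p025 read as images by this seat.)

WHAT THIS MODULE PROVES (kernel, [folklore]).  The SECOND of the five piece differences of
`B5G183RatePieces.residual_eq_pieces` for the typed residual `B5G183RateO2Op.OrderTwoOpRateResidualW1`:
 §1 `wt_w1` (the weights `W∂_ν`, `W∂_{ν′}` are admissible for b05, `Fiber.Wt_of_orders` with orders
    `1, 1`), `xw_w1_zero` / `xw_w1_ne` (b05's vector `(w x_μ)′` of Bałaban's fibre is `W∂(q̃_K)·xP(q̃_K)`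
    off the centre, `0` at the centre; `B5G183Rate.fiber_x_eq`);
 §2 **`l2n_xw_diff_le`**: the `ℓ²` eta-rate of the weighted x-vector between the levels,
    `|(W∂x_μ)′^{(RN)} − extV (W∂x_μ)′^{(N)}|₂ ≤ √XR2/N` (`B5G183RatePieces.sum_sq_sub_extV`; paired part
    `B5G183RateL2.xVec_rate_sq_le` with the weight hypotheses `B5G183RatePieces.w1dSym_weight_hyps`,
    unpaired tail `xVec_unpaired_sq_le`);
 §3 `cR_diff_le` (`|aφ^{(RN)⁻¹}_μ − aφ^{(N)⁻¹}_μ| ≤ a²C_φ/N²`, `B5QGQ199Rate.inv_phiMu_rate`),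
    **`opNorm_R_piece_W1_le`**: `‖blockR cR^{(RN)} (W∂x)′ (W∂x)′ − blockR cR^{(N)} (extV …) (extV …)‖
    ≤ CRW1(d,a)/N` (`B5G183RatePieces.opNorm_blockR_sub_blockR_le`, uniform sizes `|(wx)′|₂ ≤ 1` from b05's
    `Fiber.l2n_xw_le_one`), and **`residualW1_le_two_pieces_add_three`**: the `W∂ ⊗ W∂` residual is
    `≤ (CdgW1 + CRW1)/N +` the three remaining piece differences (`C1`, `C2`, `T`).

WHAT REMAINS / NOT CLAIMED: the piece differences `C1`, `C2` (centre × off-centre x-blocks) and `T`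
(rank one, vectors `b`) of the `W∂ ⊗ W∂` residual; `OrderTwoOpRateResidualW1` stays OPEN; nothing about
print.
-/

noncomputable section

namespace Literature.MathematicalPhysics.QuantumFieldTheory.Balaban1983to89.B5G183RateW1BlockR

open scoped BigOperators ComplexConjugate Matrix.Norms.L2Operator
open Finset Complex
open Literature.MathematicalPhysics.QuantumFieldTheory.Balaban1983to89.B4Strip
open Literature.MathematicalPhysics.QuantumFieldTheory.Balaban1983to89.B5Prop11Leaves
open Literature.MathematicalPhysics.QuantumFieldTheory.Balaban1983to89.B5Prop11Fiber
open Literature.MathematicalPhysics.QuantumFieldTheory.Balaban1983to89.B5Prop11Bound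
open Literature.MathematicalPhysics.QuantumFieldTheory.Balaban1983to89.B5Hk163Rate
open Literature.MathematicalPhysics.QuantumFieldTheory.Balaban1983to89.B5Hk163RateSum
open Literature.MathematicalPhysics.QuantumFieldTheory.Balaban1983to89.B5G183Rate
open Literature.MathematicalPhysics.QuantumFieldTheory.Balaban1983to89.B5G183RateSum
open Literature.MathematicalPhysics.QuantumFieldTheory.Balaban1983to89.B5G183RateL2
open Literature.MathematicalPhysics.QuantumFieldTheory.Balaban1983to89.B5G183RateOp
open Literature.MathematicalPhysics.QuantumFieldTheory.Balaban1983to89.B5G183RateO2Diag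
open Literature.MathematicalPhysics.QuantumFieldTheory.Balaban1983to89.B5G183RateO2Op
open Literature.MathematicalPhysics.QuantumFieldTheory.Balaban1983to89.B5G183RatePieces
open Literature.MathematicalPhysics.QuantumFieldTheory.Balaban1983to89.B5G183RateW1Diag
open Literature.MathematicalPhysics.QuantumFieldTheory.King1986

variable {d : ℕ}

/-! ## §1 Admissibility of the weights and the x-vectors of Bałaban's fibre [folklore] -/

section LevelN

variable {n : ℕ} [NeZero n]

/-- `|W∂_ν(q̃_k)|² ≤ |∂_ν(q̃_k)|² ≤ Δ(p′ + k)`: the weight `W∂` has derivative order one. [folklore] -/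
theorem norm_w1dSym_sq_le_Delta (hn : 1 ≤ n) (a : ℝ) (ha : 0 < a) {s : Fin d → ℝ}
    (hs : ∀ ν, |s ν| ≤ Real.pi) (hs0 : s ≠ 0) (ν : Fin d) (k : Fin d → Fin n) :
    ‖w1dSym n k s ν‖ ^ 2 ≤ (balabanFiber n hn a ha s hs hs0).Δ k ^ 1 := by
  have hW := Wc_nonneg_le_one k hs
  have h1 : ‖w1dSym n k s ν‖ ≤ ‖dSym n k s ν‖ := by
    unfold w1dSym
    rw [norm_mul, Complex.norm_real, Real.norm_eq_abs, abs_of_nonneg hW.1]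
    calc Wc n k s * ‖dSym n k s ν‖ ≤ 1 * ‖dSym n k s ν‖ := by gcongr; exact hW.2
      _ = _ := one_mul _
  calc ‖w1dSym n k s ν‖ ^ 2 ≤ ‖dSym n k s ν‖ ^ 2 := pow_le_pow_left₀ (norm_nonneg _) h1 2
    _ ≤ DeltaXir n 0 (shiftr n k s) ^ 1 := weight_order_one n s ν k
    _ = _ := rfl

/-- **the weights `W∂_ν ⊗ W∂_{ν′}` are admissible for b05** (`Fiber.Wt`, orders `1 + 1 ≤ 2`). [folklore] -/
theorem wt_w1 (hn : 1 ≤ n) (a : ℝ) (ha : 0 < a) {s : Fin d → ℝ} (hs : ∀ ν, |s ν| ≤ Real.pi)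
    (hs0 : s ≠ 0) (ν ν' : Fin d) :
    (balabanFiber n hn a ha s hs hs0).Wt (fun K => w1dSym n K s ν) (fun K => w1dSym n K s ν') :=
  (balabanFiber n hn a ha s hs hs0).Wt_of_orders (j₁ := 1) (j₂ := 1) (by norm_num)
    (norm_w1dSym_sq_le_Delta hn a ha hs hs0 ν) (norm_w1dSym_sq_le_Delta hn a ha hs hs0 ν')

/-- b05's off-centre x-vector vanishes at the centre. [folklore] -/
theorem xw_zero (hn : 1 ≤ n) (a : ℝ) (ha : 0 < a) {s : Fin d → ℝ} (hs : ∀ ν, |s ν| ≤ Real.pi)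
    (hs0 : s ≠ 0) (w : (Fin d → Fin n) → ℂ) (μ : Fin d) :
    (balabanFiber n hn a ha s hs hs0).xw w μ 0 = 0 := by
  have ho : (balabanFiber n hn a ha s hs hs0).o = 0 := rfl
  unfold Fiber.xw
  rw [if_pos ho.symm]

/-- off the centre b05's x-vector of Bałaban's fibre is `w(K)·xP(q̃_K)` (`B5G183Rate.fiber_x_eq` at the
symmetric representative). [cite: Balaban1984PropagatorsI, (1.83) p.31] [folklore] -/
theorem xw_ne (hn : 1 ≤ n) (a : ℝ) (ha : 0 < a) {s : Fin d → ℝ} (hs : ∀ ν, |s ν| ≤ Real.pi)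
    (hs0 : s ≠ 0) (w : (Fin d → Fin n) → ℂ) (μ : Fin d) {K : Fin d → Fin n} (hK : K ≠ 0) :
    (balabanFiber n hn a ha s hs hs0).xw w μ K = w K * xP n μ (symmAlias n K s) := by
  have hK' : K ≠ (balabanFiber n hn a ha s hs hs0).o := hK
  unfold Fiber.xw
  rw [if_neg hK', fiber_x_eq hn a ha s hs hs0 (isRep_symmAlias hn K hs) μ]

/-- `|(wx_μ)′|₂ ≤ 1` for the weights `W∂` (b05 `Fiber.l2n_xw_le_one`). [folklore] -/
theorem l2n_xw_w1_le_one (hn : 1 ≤ n) (a : ℝ) (ha : 0 < a) {s : Fin d → ℝ}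
    (hs : ∀ ν, |s ν| ≤ Real.pi) (hs0 : s ≠ 0) (ν ν' μ : Fin d) :
    l2n ((balabanFiber n hn a ha s hs hs0).xw (fun K => w1dSym n K s ν) μ) ≤ 1
      ∧ l2n ((balabanFiber n hn a ha s hs hs0).xw (fun K => w1dSym n K s ν') μ) ≤ 1 :=
  ⟨(balabanFiber n hn a ha s hs hs0).l2n_xw_le_one (wt_w1 hn a ha hs hs0 ν ν').left_le μ,
    (balabanFiber n hn a ha s hs hs0).l2n_xw_le_one (wt_w1 hn a ha hs hs0 ν ν').right_le μ⟩

/-- `‖cR_μ‖ = a/φ_μ ≤ a`. [folklore] -/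
theorem norm_cR_le (hn : 1 ≤ n) (a : ℝ) (ha : 0 < a) {s : Fin d → ℝ} (hs : ∀ ν, |s ν| ≤ Real.pi)
    (hs0 : s ≠ 0) (μ : Fin d) : ‖(balabanFiber n hn a ha s hs hs0).cR μ‖ ≤ a := by
  rw [Fiber.norm_cR]
  have hφ := (balabanFiber n hn a ha s hs hs0).one_le_φ μ
  have ha' : (balabanFiber n hn a ha s hs hs0).a = a := rfl
  rw [ha']
  calc a / (balabanFiber n hn a ha s hs hs0).φ μ ≤ a / 1 := by gcongr
    _ = a := div_one a

end LevelN

/-! ## §2 The `ℓ²` eta-rate of the weighted x-vector between the levels [folklore] -/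

section Rate

variable {N R : ℕ} [NeZero N] [NeZero R]

/-- constant of the squared `ℓ²` rate: paired part `2((A_x d CXa)² + (6CXa)²)·CW` + unpaired tail
`(CXa/π)²·CW`. [folklore] -/
def XR2 (d : ℕ) : ℝ :=
  2 * ((Ax d * d * CXa d) ^ 2 + (6 * CXa d) ^ 2) * CW d + (CXa d / Real.pi) ^ 2 * CW d

omit [NeZero N] [NeZero R] in
/-- `0 ≤ XR2`. [folklore] -/
theorem XR2_nonneg (d : ℕ) : 0 ≤ XR2 d := by
  have hW := CW_nonneg d
  unfold XR2; positivity

/-- **squared `ℓ²` eta-rate of `(W∂_ν x_μ)′`:** `Σ_K |(W∂x_μ)′^{(RN)}(K) − extV (W∂x_μ)′^{(N)}(K)|² ≤ XR2/N²`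
— King's `m = 0` classes through `xVec_rate_sq_le` (the centre class contributes `0`), the `|m| ≥ 1`
classes through `xVec_unpaired_sq_le`. [cite: King1986, (4.19)–(4.20), (4.23) p.672, (4.24) p.673;
Balaban1984PropagatorsI, (1.83) p.31] [folklore] -/
theorem sum_sq_xw_diff_le (hN : 1 ≤ N) (hR : 1 ≤ R) (hRN : 1 ≤ R * N) (a : ℝ) (ha : 0 < a)
    {s : Fin d → ℝ} (hs : ∀ ν, |s ν| ≤ Real.pi) (hs0 : s ≠ 0) (ν μ : Fin d) :
    ∑ K, ‖(balabanFiber (R * N) hRN a ha s hs hs0).xw (fun K => w1dSym (R * N) K s ν) μ K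
        - extV R s ((balabanFiber N hN a ha s hs hs0).xw (fun k => w1dSym N k s ν)) μ K‖ ^ 2
      ≤ XR2 d / (N : ℝ) ^ 2 := by
  obtain ⟨ν₀, hν₀⟩ : ∃ ν, s ν ≠ 0 := Function.ne_iff.mp hs0
  have hN0 : (0 : ℝ) < N := by exact_mod_cast hN
  have hwgt := w1dSym_weight_hyps (N := N) (R := R) hN hR hs ν
  rw [sum_sq_sub_extV hN hs]
  -- paired classes: the centre term vanishes, the rest is `xVec_rate_sq_le`
  have hpaired : ∑ k : Fin d → Fin N,
      ‖(balabanFiber (R * N) hRN a ha s hs hs0).xw (fun K => w1dSym (R * N) K s ν) μ (iota R k s)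
          - (balabanFiber N hN a ha s hs hs0).xw (fun k => w1dSym N k s ν) μ k‖ ^ 2
        ≤ 2 * ((Ax d * d * CXa d) ^ 2 + (6 * CXa d) ^ 2) * CW d / (N : ℝ) ^ 2 := by
    rw [← Finset.add_sum_erase _ _ (Finset.mem_univ (0 : Fin d → Fin N)), iota_zero hN hs,
      xw_zero hRN a ha hs hs0, xw_zero hN a ha hs hs0, sub_zero, norm_zero, zero_pow two_ne_zero,
      zero_add]
    refine le_of_eq_of_le (Finset.sum_congr rfl fun k hk => ?_)
      (xVec_rate_sq_le hN hR hs ν₀ hν₀ μ (wN := fun k => w1dSym N k s ν)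
        (wR := fun K => w1dSym (R * N) K s ν) (cw := 6) (by norm_num) hwgt.1 hwgt.2)
    have hk0 : k ≠ 0 := (Finset.mem_erase.mp hk).1
    have hK : iota R k s ≠ 0 := fun h => hk0 (iota_injective hN hs (h.trans (iota_zero hN hs).symm))
    rw [xw_ne hRN a ha hs hs0 _ μ hK, xw_ne hN a ha hs hs0 _ μ hk0, symmAlias_iota hN k hs,
      norm_sub_rev]
  -- unpaired classes: `xVec_unpaired_sq_le`
  have hunp : ∑ K ∈ Finset.univ.filter (fun K => ∀ k : Fin d → Fin N, iota R k s ≠ K),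
      ‖(balabanFiber (R * N) hRN a ha s hs hs0).xw (fun K => w1dSym (R * N) K s ν) μ K‖ ^ 2
        ≤ (CXa d / (Real.pi * N)) ^ 2 * CW d := by
    have hw1 : ∀ K : Fin d → Fin (R * N), ‖w1dSym (R * N) K s ν‖ ≤ ‖symmAlias (R * N) K s‖ :=
      (w1dSym_weight_hyps (N := R * N) (R := 1) hRN le_rfl hs ν).1
    refine le_of_eq_of_le (Finset.sum_congr rfl fun K hK => ?_)
      (xVec_unpaired_sq_le hN hR hs ν₀ hν₀ μ hw1)
    have hu := (Finset.mem_filter.mp hK).2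
    have hK0 : K ≠ 0 := fun h => hu 0 ((iota_zero hN hs).trans h.symm)
    rw [xw_ne hRN a ha hs hs0 _ μ hK0]
  calc _ ≤ 2 * ((Ax d * d * CXa d) ^ 2 + (6 * CXa d) ^ 2) * CW d / (N : ℝ) ^ 2
          + (CXa d / (Real.pi * N)) ^ 2 * CW d := add_le_add hpaired hunp
    _ = XR2 d / (N : ℝ) ^ 2 := by unfold XR2; field_simp

/-- **`ℓ²` eta-rate of `(W∂_ν x_μ)′`:** `|(W∂x_μ)′^{(RN)} − extV (W∂x_μ)′^{(N)}|₂ ≤ √XR2/N`. [folklore] -/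
theorem l2n_xw_diff_le (hN : 1 ≤ N) (hR : 1 ≤ R) (hRN : 1 ≤ R * N) (a : ℝ) (ha : 0 < a)
    {s : Fin d → ℝ} (hs : ∀ ν, |s ν| ≤ Real.pi) (hs0 : s ≠ 0) (ν μ : Fin d) :
    l2n ((balabanFiber (R * N) hRN a ha s hs hs0).xw (fun K => w1dSym (R * N) K s ν) μ
        - extV R s ((balabanFiber N hN a ha s hs hs0).xw (fun k => w1dSym N k s ν)) μ)
      ≤ Real.sqrt (XR2 d) / N := by
  have hN0 : (0 : ℝ) < N := by exact_mod_cast hN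
  have hX := XR2_nonneg d
  refine l2n_le_of_sq_le (by positivity) ?_
  rw [div_pow, Real.sq_sqrt hX]
  exact sum_sq_xw_diff_le hN hR hRN a ha hs hs0 ν μ

omit [NeZero N] in
/-- `|extV y|₂ = |y|₂` componentwise (the zero-extension is an isometry). [folklore] -/
theorem l2n_extV (hN : 1 ≤ N) {s : Fin d → ℝ} (hs : ∀ ν, |s ν| ≤ Real.pi)
    (y : Fin d → (Fin d → Fin N) → ℂ) (μ : Fin d) :
    l2n (extV R s y μ) = l2n (y μ) := by
  unfold l2n
  rw [sum_sq_extV hN hs]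

end Rate

/-! ## §3 The x-block piece `R` of the `W∂ ⊗ W∂` residual is `O(1/N)` [folklore] -/

section Main

variable {N R : ℕ} [NeZero N] [NeZero R]

/-- **rate of the coefficient `cR_μ = −aφ_μ⁻¹` between the levels:** `‖cR^{(RN)}_μ − cR^{(N)}_μ‖ ≤ a²C_φ/N²`
(`B5G183Rate.fiber_φ_eq`, `B5QGQ199Rate.inv_phiMu_rate`). [cite: Balaban1984PropagatorsI, (1.84)–(1.85)
p.32] [folklore] -/
theorem cR_diff_le (hN : 1 ≤ N) (hR : 1 ≤ R) (hRN : 1 ≤ R * N) (a : ℝ) (ha : 0 < a)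
    {s : Fin d → ℝ} (hs : ∀ ν, |s ν| ≤ Real.pi) (hs0 : s ≠ 0) (μ : Fin d) :
    ‖(balabanFiber (R * N) hRN a ha s hs hs0).cR μ - (balabanFiber N hN a ha s hs hs0).cR μ‖
      ≤ a ^ 2 * B5ActionRate166.Cphi / (N : ℝ) ^ 2 := by
  obtain ⟨ν₀, hν₀⟩ : ∃ ν, s ν ≠ 0 := Function.ne_iff.mp hs0
  have hφR := fiber_φ_eq hRN a ha s hs hs0 μ
  have hφN := fiber_φ_eq hN a ha s hs hs0 μ
  have haR : (balabanFiber (R * N) hRN a ha s hs hs0).a = a := rfl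
  have haN : (balabanFiber N hN a ha s hs hs0).a = a := rfl
  have h := B5QGQ199Rate.inv_phiMu_rate (N := N) (R := R) hN hR a ha.le μ s hs ν₀ hν₀
  unfold Fiber.cR
  rw [haR, haN, hφR, hφN]
  have e : -((a : ℂ) / (phiMu (R * N) a μ s : ℂ))
        - -((a : ℂ) / (phiMu N a μ s : ℂ))
      = (a : ℂ) * (((1 / phiMu N a μ s - 1 / phiMu (R * N) a μ s : ℝ)) : ℂ) := by
    push_cast; ring
  rw [e, norm_mul, Complex.norm_real, Complex.norm_real, Real.norm_eq_abs, Real.norm_eq_abs,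
    abs_of_pos ha]
  calc a * |1 / phiMu N a μ s - 1 / phiMu (R * N) a μ s|
      ≤ a * (a * (B5ActionRate166.Cphi * ((N : ℝ) ^ 2)⁻¹)) := mul_le_mul_of_nonneg_left h ha.le
    _ = a ^ 2 * B5ActionRate166.Cphi / (N : ℝ) ^ 2 := by ring

/-- constant of the `R` piece: `a²C_φ + 2a√XR2`. [folklore] -/
def CRW1 (d : ℕ) (a : ℝ) : ℝ := a ^ 2 * B5ActionRate166.Cphi + 2 * a * Real.sqrt (XR2 d)

omit [NeZero N] [NeZero R] in
/-- `0 ≤ CRW1` for `0 ≤ a`. [folklore] -/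
theorem CRW1_nonneg (d : ℕ) {a : ℝ} (ha : 0 ≤ a) : 0 ≤ CRW1 d a := by
  have hC := B5ActionRate166.Cphi_pos
  unfold CRW1; positivity

/-- **THE x-BLOCK PIECE `R` OF THE `W∂_ν ⊗ W∂_{ν′}` ORDER-TWO eta-RATE IS `O(1/N)`:**
`‖blockR cR^{(RN)} (W∂_ν x)′^{(RN)} (W∂_{ν′} x)′^{(RN)} − blockR cR^{(N)} (extV (W∂_ν x)′^{(N)}) (extV (W∂_{ν′} x)′^{(N)})‖
≤ CRW1(d,a)/N` — the trilinear split `B5G183RatePieces.opNorm_blockR_sub_blockR_le` with the coefficient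
rate `cR_diff_le`, the vector rates `l2n_xw_diff_le` and the uniform sizes `|(wx)′|₂ ≤ 1`, `|cR| ≤ a`.
[cite: Balaban1984PropagatorsI, (1.83) p.31, Prop. 1.1 (1.89) p.33; King1986, (4.19)–(4.20), (4.23)
p.672, (4.24) p.673] [folklore] -/
theorem opNorm_R_piece_W1_le (hN : 1 ≤ N) (hR : 1 ≤ R) (hRN : 1 ≤ R * N) (a : ℝ) (ha : 0 < a)
    {s : Fin d → ℝ} (hs : ∀ ν, |s ν| ≤ Real.pi) (hs0 : s ≠ 0) (ν ν' : Fin d) :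
    let F := balabanFiber (R * N) hRN a ha s hs hs0
    let F' := balabanFiber N hN a ha s hs hs0
    ‖blockR F.cR (F.xw fun K => w1dSym (R * N) K s ν) (F.xw fun K => w1dSym (R * N) K s ν')
        - blockR F'.cR (extV R s (F'.xw fun k => w1dSym N k s ν))
            (extV R s (F'.xw fun k => w1dSym N k s ν'))‖
      ≤ CRW1 d a / N := by
  intro F F'
  have hN0 : (0 : ℝ) < N := by exact_mod_cast hN
  have hN1 : (1 : ℝ) ≤ N := by exact_mod_cast hN
  have hC := B5ActionRate166.Cphi_pos
  have hX : 0 ≤ Real.sqrt (XR2 d) := Real.sqrt_nonneg _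
  -- sizes
  have hszR := fun μ => l2n_xw_w1_le_one hRN a ha hs hs0 ν ν' μ
  have hszN := fun μ => l2n_xw_w1_le_one hN a ha hs hs0 ν ν' μ
  have hcN := fun μ => norm_cR_le hN a ha hs hs0 μ
  -- rates
  have hcd := fun μ => cR_diff_le hN hR hRN a ha hs hs0 μ
  have hva := fun μ => l2n_xw_diff_le hN hR hRN a ha hs hs0 ν μ
  have hvb := fun μ => l2n_xw_diff_le hN hR hRN a ha hs hs0 ν' μ
  have key := opNorm_blockR_sub_blockR_le F.cR F'.cR
    (F.xw fun K => w1dSym (R * N) K s ν) (extV R s (F'.xw fun k => w1dSym N k s ν))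
    (F.xw fun K => w1dSym (R * N) K s ν') (extV R s (F'.xw fun k => w1dSym N k s ν'))
    (K₁ := a ^ 2 * B5ActionRate166.Cphi / (N : ℝ) ^ 2) (K₂ := a * (Real.sqrt (XR2 d) / N))
    (K₃ := a * (Real.sqrt (XR2 d) / N)) (by positivity) (by positivity) (by positivity)
    (fun μ => by
      calc _ ≤ a ^ 2 * B5ActionRate166.Cphi / (N : ℝ) ^ 2 * (1 * 1) := by
            gcongr
            · exact mul_nonneg (l2n_nonneg _) (l2n_nonneg _)
            · exact hcd μ
            · exact l2n_nonneg _
            · exact (hszR μ).1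
            · exact (hszR μ).2
        _ = _ := by ring)
    (fun μ => by
      calc _ ≤ a * (Real.sqrt (XR2 d) / N * 1) := by
            gcongr
            · exact mul_nonneg (l2n_nonneg _) (l2n_nonneg _)
            · exact hcN μ
            · exact l2n_nonneg _
            · exact hva μ
            · exact (hszR μ).2
        _ = _ := by ring)
    (fun μ => by
      rw [l2n_extV hN hs]
      calc _ ≤ a * (1 * (Real.sqrt (XR2 d) / N)) := by
            gcongr
            · exact mul_nonneg (l2n_nonneg _) (l2n_nonneg _)
            · exact hcN μ
            · exact l2n_nonneg _
            · exact (hszN μ).1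
            · exact hvb μ
        _ = _ := by ring)
  refine key.trans ?_
  have h2 : a ^ 2 * B5ActionRate166.Cphi / (N : ℝ) ^ 2 ≤ a ^ 2 * B5ActionRate166.Cphi / N :=
    div_le_div_of_nonneg_left (by positivity) hN0 (by nlinarith)
  calc a ^ 2 * B5ActionRate166.Cphi / (N : ℝ) ^ 2 + a * (Real.sqrt (XR2 d) / N)
        + a * (Real.sqrt (XR2 d) / N)
      ≤ a ^ 2 * B5ActionRate166.Cphi / N + a * (Real.sqrt (XR2 d) / N)
        + a * (Real.sqrt (XR2 d) / N) := by gcongr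
    _ = CRW1 d a / N := by unfold CRW1; ring

/-- **consequence for the typed residual:** the `W∂ ⊗ W∂` residual is bounded by `(CdgW1 + CRW1)/N` plus
the THREE remaining finite-rank piece differences (`C1`, `C2`, `T`).
[cite: Balaban1984PropagatorsI, Prop. 1.1 (1.89) p.33; King1986, (4.19) p.672] [folklore] -/
theorem residualW1_le_two_pieces_add_three (hN : 1 ≤ N) (hR : 1 ≤ R) (hRN : 1 ≤ R * N) (a : ℝ)
    (ha : 0 < a) {s : Fin d → ℝ} (hs : ∀ ν, |s ν| ≤ Real.pi) (hs0 : s ≠ 0) (ν ν' : Fin d) :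
    let F := balabanFiber (R * N) hRN a ha s hs hs0
    let F' := balabanFiber N hN a ha s hs hs0
    let wa : (Fin d → Fin (R * N)) → ℂ := fun K => w1dSym (R * N) K s ν
    let wb : (Fin d → Fin (R * N)) → ℂ := fun K => w1dSym (R * N) K s ν'
    let wa' : (Fin d → Fin N) → ℂ := fun k => w1dSym N k s ν
    let wb' : (Fin d → Fin N) → ℂ := fun k => w1dSym N k s ν'
    ‖sandwich wa wb F.G - plant R s (sandwich wa' wb' F'.G)‖
      ≤ (CdgW1 d a + CRW1 d a) / N
        + ‖blockR F.cR (F.xo wa) (F.xw wb) - blockR F'.cR (extV R s (F'.xo wa')) (extV R s (F'.xw wb'))‖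
        + ‖blockR F.cR (F.xw wa) (F.xo wb) - blockR F'.cR (extV R s (F'.xw wa')) (extV R s (F'.xo wb'))‖
        + ‖rankOne F.cT (F.bw wa) (F.bw wb)
            - rankOne F'.cT (extP R s (F'.bw wa')) (extP R s (F'.bw wb'))‖ := by
  have h1 := residualW1_le_diag_add_finiteRank (N := N) (R := R) hN hR hRN a ha hs hs0 ν ν'
  have h2 := opNorm_R_piece_W1_le hN hR hRN a ha hs hs0 ν ν'
  dsimp only at h1 h2 ⊢
  rw [add_div]
  linarith

end Main

end Literature.MathematicalPhysics.QuantumFieldTheory.Balaban1983to89.B5G183RateW1BlockR
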